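import Mathlib.Tactic
import HarnessLib

/-!
# Kozma–Nitzan's Question 8 — the flat uniform form `UNIF-G♭` and the λ-matched prefix lemma (gen 35)

Support file (`--supports stmt-CriticalPhenomena-4575`, closed crux; independent mathematics on Kozma–Nitzan's Question 8,
arXiv:2401.12397 §5.5 p. 36), prover `prim-ineq-gen-6` (gen 35).  No definitions, no named facts, no sorries; standard axioms.
Memo `run/shared/lean/prim/prim-ineq-gen-6/PROOF-UNIFGFLAT-G35.md`.

Gen 34 reduced the nested uniform form `UNIF-G′(i)` (the `k₁ ≥ 2` target) to `UNIF-G^ρ` of the re-rooted tail block plus a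
one-step prefix lemma, with an R-budget conflict (the proved deep chain needs ≈ 0.7 of the R-kill, the proved prefix lemma 0.84).
Gen 35 resolves the conflict by changing the CURRENCY: the deep block spares not a fraction of its R-kill
`R_l = ¾w_lκ_l v̂_{l+1}(1−α_l)/α_l` but the smaller *flat* part `R♭♭_l := ¾w_lκ_l v_{l+1} ā_l` (no `1/α_l`, no `1/p_l`,
`ā_l` = LEMMA B's averaged A-defect), which is exactly what LEMMA B converts into the prefix's budget.  The flat family
`UNIF-G♭(c)`: `w x₀ + Σ_{l<k} X_l + c·Σ_{l<k} R♭♭_l ≤ 0` is merge-compatible (`kFl_flat_merge_identity`: the merged block's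
flat kill differs by a term proportional to vertex 1's A-defect only), so the merge step needs, on top of the proved step
`(M′)`, only `(1−A₁)`-proportional budget: at depth 1 the kill `R₁′` is freed by re-routing CLAIM Z's remainder into the slack
of the `LL′`-kill (`kFl_lemmaF`, `kFl_rem_core`, `kFl_CZ_identity`), at depth `l ≥ 2` the pooled `(1−A₁)`-budget line
`kFl_depth_budget` holds with the explicit allowance `c_deep(λ) = 1 − (4/3)λ(1−λ) − (4/3)λ²(1−λ−λ²)⁺/(1+λ)` (`kFl_cdeep_ok`).
Hence (memo, merge induction `merge_induction` p327779) `UNIF-G♭(c_deep(λ))` for every block at every first crossing, and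
`UNIF-G′(i) ⟸ PRE_i − CR_i ≤ c_deep(λ_i)·¾κ_iB̃_i/(1+λ_i)` (`kFl_red_flat`).  For `i = 1` the prefix lemma of gen 34
(`…KnQuestion8SubrootReduction.lean`, pieces `r₂+r₃+r₅+r₆`) is re-budgeted against `c_deep(λ₁)`, `λ₁ = λA₁s₂`: the termwise
majorants `kFl_T2a`, `kFl_T2b`, `kFl_T3a`, `kFl_T5`, `kFl_T6` reduce it to a scalar inequality in `(λ, λ₁, z, t)` which is
certified by an exact-rational box partition (memo §6, `lab-g35/cert/fsi_cert.py`, 137 boxes).  Consequence (memo):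
*** `UNIF-G′(1)` holds for EVERY block *** (gen 34 had it only for `k(1) = 3`).
[cite: KozmaNitzan2024, Question 8 (§5.5 p. 36)]
-/

namespace Summit.CriticalPhenomena.PercolationContinuityZ3.Theorems

namespace PocketCert

/-- **Flat merge identity.**  With `ā = ω₁·a + s₂·ā^m` (the merged block's averaged A-defect drops the cut-class `{1}` term,
`ω₁ = 1 − s₂`, `a = 1 − A₁`) the flat kills `R♭♭ = ¾wκv·ā`, `R♭♭^m = ¾wκv·ā^m` satisfy
`R♭♭ = s₂·R♭♭^m + (1−s₂)·a·¾wκv`: the flat excess is proportional to vertex 1's A-defect only.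
[cite: KozmaNitzan2024, Question 8 (§5.5 p. 36)] -/
theorem kFl_flat_merge_identity (w κ v abar abarm a s₂ Rbb Rbbm : ℝ)
    (habar : abar = (1 - s₂) * a + s₂ * abarm) (hR : Rbb = 3 / 4 * w * κ * v * abar)
    (hRm : Rbbm = 3 / 4 * w * κ * v * abarm) :
    Rbb = s₂ * Rbbm + (1 - s₂) * a * (3 / 4 * w * κ * v) := by
  subst hR; subst hRm; rw [habar]; ring

/-- **LEMMA F** (the `LL′`-slack absorbs CLAIM Z's remainder in the regime `v ≤ λ′m`).  For `0 ≤ λ ≤ 1`,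
`C ≤ A ≤ 1` and `(1+λ)C ≥ 1` (vertex 1 not crossed):
`((1+λ)C − 1)·(A − C)·[λA + (1−λ²)(1−A)] ≤ (1−C)·λ²·A²`.
Proof: with `a = 1−A`, `d = A−C` the difference equals `aλ²A² + adλ(λ²−a) + (1+λ)λAd² + (1+λ)ad(a+d)(1−λ²)`; if
`(1+λ)(1−λ²) ≥ λ` every term is covered, otherwise `λ(1+λ) ≥ 1` and `a(1+λ) ≤ λ` give `adλ(λ² − a) ≥ adλ²(λ(1+λ)−1)/(1+λ) ≥ 0`.
[cite: KozmaNitzan2024, Question 8 (§5.5 p. 36)] -/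
theorem kFl_lemmaF (lam A C : ℝ) (hl0 : 0 ≤ lam) (hl1 : lam ≤ 1) (hCA : C ≤ A) (hA1 : A ≤ 1)
    (hC : 1 ≤ (1 + lam) * C) :
    ((1 + lam) * C - 1) * (A - C) * (lam * A + (1 - lam ^ 2) * (1 - A)) ≤ (1 - C) * lam ^ 2 * A ^ 2 := by
  -- a = 1 - A ≥ 0, d = A - C ≥ 0, a + d = 1 - C ≤ lam/(1+lam)
  have ha : 0 ≤ 1 - A := by linarith
  have hd : 0 ≤ A - C := by linarith
  have hA0 : 0 ≤ A := by nlinarith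
  have hsum : (1 - A) * (1 + lam) ≤ lam := by nlinarith
  have h1l2 : 0 ≤ 1 - lam ^ 2 := by nlinarith
  have key : (1 - C) * lam ^ 2 * A ^ 2 - ((1 + lam) * C - 1) * (A - C) * (lam * A + (1 - lam ^ 2) * (1 - A))
      = (1 - A) * lam ^ 2 * A ^ 2 + (1 - A) * (A - C) * lam * (lam ^ 2 - (1 - A))
        + (1 + lam) * lam * A * (A - C) ^ 2 + (1 + lam) * (1 - A) * (A - C) * ((1 - A) + (A - C)) * (1 - lam ^ 2) := by
    ring
  have t1 : 0 ≤ (1 - A) * lam ^ 2 * A ^ 2 := by positivity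
  have t3 : 0 ≤ (1 + lam) * lam * A * (A - C) ^ 2 := by positivity
  have t4a : 0 ≤ (1 + lam) * (1 - A) * (A - C) * (A - C) * (1 - lam ^ 2) := by positivity
  -- the a²d-part of t4 and t2 together
  have split4 : (1 + lam) * (1 - A) * (A - C) * ((1 - A) + (A - C)) * (1 - lam ^ 2)
      = (1 + lam) * (1 - A) * (A - C) * (A - C) * (1 - lam ^ 2)
        + (1 - A) ^ 2 * (A - C) * ((1 + lam) * (1 - lam ^ 2)) := by ring
  have core : 0 ≤ (1 - A) * (A - C) * lam * (lam ^ 2 - (1 - A)) + (1 - A) ^ 2 * (A - C) * ((1 + lam) * (1 - lam ^ 2)) := by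
    rcases le_or_gt lam ((1 + lam) * (1 - lam ^ 2)) with h | h
    · -- case 1: (1+lam)(1-lam²) ≥ lam: a²d[(1+lam)(1-lam²) - lam] ≥ 0 and a d lam³ ≥ 0
      have e : (1 - A) * (A - C) * lam * (lam ^ 2 - (1 - A)) + (1 - A) ^ 2 * (A - C) * ((1 + lam) * (1 - lam ^ 2))
          = (1 - A) * (A - C) * lam ^ 3 + (1 - A) ^ 2 * (A - C) * ((1 + lam) * (1 - lam ^ 2) - lam) := by ring
      have u1 : 0 ≤ (1 - A) * (A - C) * lam ^ 3 := by positivity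
      have u2 : 0 ≤ (1 - A) ^ 2 * (A - C) * ((1 + lam) * (1 - lam ^ 2) - lam) := by
        have : 0 ≤ (1 + lam) * (1 - lam ^ 2) - lam := by linarith
        positivity
      linarith [e, u1, u2]
    · -- case 2: (1+lam)(1-lam²) < lam, hence lam(1+lam) ≥ 1; with a(1+lam) ≤ lam
      have hgold : 1 ≤ lam * (1 + lam) := by
        by_contra hh
        rw [not_le] at hh
        have : lam < (1 + lam) * (1 - lam ^ 2) := by nlinarith
        linarith
      have u2 : -((1 - A) ^ 2 * (A - C) * lam)
          ≤ (1 - A) ^ 2 * (A - C) * ((1 + lam) * (1 - lam ^ 2)) := by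
        have : 0 ≤ (1 - A) ^ 2 * (A - C) * ((1 + lam) * (1 - lam ^ 2)) := by positivity
        have : 0 ≤ (1 - A) ^ 2 * (A - C) * lam := by positivity
        linarith
      -- a d lam (lam² - a) - a² d lam = a d lam (lam² - 2a)?  No: we need a d lam(lam² - a) ≥ a² d lam, i.e. lam² ≥ 2a? Not used.
      -- Instead: a d lam (lam² - a) + [t4's a²d part] ≥ a d lam (lam² - a) - a² d lam·0 ... use a(1+lam) ≤ lam twice:
      -- (1+lam)·[a d lam (lam² - a) - a² d lam] is not needed; we show (1+lam)·(a d lam(lam² - a)) ≥ a d lam (lam²(1+lam) - lam)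
      have u3 : (1 - A) * (A - C) * lam * (lam ^ 2 * (1 + lam) - lam)
          ≤ (1 + lam) * ((1 - A) * (A - C) * lam * (lam ^ 2 - (1 - A))) := by
        have hadl : 0 ≤ (1 - A) * (A - C) * lam := by positivity
        nlinarith [mul_nonneg hadl (by linarith : (0:ℝ) ≤ lam - (1 - A) * (1 + lam))]
      have u4 : 0 ≤ (1 - A) * (A - C) * lam * (lam ^ 2 * (1 + lam) - lam) := by
        have : 0 ≤ lam ^ 2 * (1 + lam) - lam := by nlinarith
        positivity
      have u5 : 0 ≤ (1 + lam) * ((1 - A) * (A - C) * lam * (lam ^ 2 - (1 - A))) := le_trans u4 u3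
      have u6 : 0 ≤ (1 - A) * (A - C) * lam * (lam ^ 2 - (1 - A)) := by
        have h1l : (0:ℝ) < 1 + lam := by linarith
        by_contra hh
        rw [not_le] at hh
        have : (1 + lam) * ((1 - A) * (A - C) * lam * (lam ^ 2 - (1 - A))) < 0 := mul_neg_of_pos_of_neg h1l hh
        linarith
      -- and the a²d-term: (1+lam)(1-lam²) ≥ 0 so that term is ≥ 0 outright
      have u7 : 0 ≤ (1 - A) ^ 2 * (A - C) * ((1 + lam) * (1 - lam ^ 2)) := by positivity
      linarith [u6, u7]
  nlinarith [key, t1, t3, t4a, split4, core]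

/-- **CLAIM-Z part as a depth-1 quantity (exact).**  With the lens `ṽ = A·B_p/p₀`, `1+λ′ = (1+λ)C` and the far-factor
identity `A·p = p₀ + ρ` (gen 34 `kG0_Ap`):  `wṽ(1−A)(1+λ′)v = w(1+λ)(1−A)C(v/p)·B_p·(1 + ρ/p₀)`.
[cite: KozmaNitzan2024, Question 8 (§5.5 p. 36)] -/
theorem kFl_CZ_identity (w A a C v p Bp p₀ ρ lam lamp vt : ℝ) (hp : p ≠ 0) (hp0 : p₀ ≠ 0)
    (hvt : vt = A * Bp / p₀) (hAp : A * p = p₀ + ρ) (hlamp : 1 + lamp = (1 + lam) * C) :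
    w * vt * a * (1 + lamp) * v = w * (1 + lam) * a * C * (v / p) * Bp * (1 + ρ / p₀) := by
  rw [hvt, hlamp]
  have hA : A = (p₀ + ρ) / p := by field_simp; linarith [hAp]
  rw [hA]
  field_simp

/-- **REM core** (CLAIM Z's remainder fits in the `LL′`-slack; regime `v ≤ λ′m`, `A > C`).  Per unit `u/p` the remainder is
at most `w(1+λ)(1−A)C·v·s·d/A` and the unused part of `LL′` is `(1−C)λ²A·q − λλ′·s·m·d`; given LEMMA F (`hF`),
`v ≤ λ′m`, `q ≥ sm`, `w(1+λ) ≤ 1−λ²`, `C ≤ 1`:  `w(1+λ)(1−A)C·v·s·d ≤ A·[(1−C)λ²A·q − λλ′·s·m·d]`.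
[cite: KozmaNitzan2024, Question 8 (§5.5 p. 36)] -/
theorem kFl_rem_core (w lam A C v s d m q lamp : ℝ) (hw0 : 0 ≤ w) (hw : w * (1 + lam) ≤ 1 - lam ^ 2)
    (hA1 : A ≤ 1) (hC0 : 0 ≤ C) (hC1 : C ≤ 1) (hv0 : 0 ≤ v) (hv : v ≤ lamp * m) (hs : 0 ≤ s)
    (hd : 0 ≤ d) (hm : 0 ≤ m) (hq : s * m ≤ q) (hl0 : 0 ≤ lam)
    (hF : lamp * d * (lam * A + (1 - lam ^ 2) * (1 - A)) ≤ (1 - C) * lam ^ 2 * A ^ 2) :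
    w * (1 + lam) * (1 - A) * C * v * s * d ≤ A * ((1 - C) * lam ^ 2 * A * q - lam * lamp * s * m * d) := by
  have h1A : 0 ≤ 1 - A := by linarith
  have h1C : 0 ≤ 1 - C := by linarith
  -- LHS ≤ (1-lam²)(1-A)·lamp·m·s·d
  have s1 : w * (1 + lam) * (1 - A) * C * v * s * d ≤ (1 - lam ^ 2) * (1 - A) * (lamp * m) * s * d := by
    have e1 : w * (1 + lam) * (1 - A) * C * v * s * d = (w * (1 + lam)) * C * v * ((1 - A) * s * d) := by ring
    have e2 : (1 - lam ^ 2) * (1 - A) * (lamp * m) * s * d = (1 - lam ^ 2) * 1 * (lamp * m) * ((1 - A) * s * d) := by ring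
    rw [e1, e2]
    have hk : 0 ≤ (1 - A) * s * d := by positivity
    have a1 : (w * (1 + lam)) * C * v ≤ (1 - lam ^ 2) * 1 * (lamp * m) := by
      have b1 : (w * (1 + lam)) * C * v ≤ (1 - lam ^ 2) * C * v := by
        have : 0 ≤ C * v := by positivity
        nlinarith
      have h1l2 : 0 ≤ 1 - lam ^ 2 := by nlinarith [mul_nonneg hw0 (by linarith : (0:ℝ) ≤ 1 + lam)]
      have b2 : (1 - lam ^ 2) * C * v ≤ (1 - lam ^ 2) * 1 * v := by
        have : 0 ≤ (1 - lam ^ 2) * v := mul_nonneg h1l2 hv0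
        nlinarith
      have b3 : (1 - lam ^ 2) * 1 * v ≤ (1 - lam ^ 2) * 1 * (lamp * m) := by
        nlinarith [mul_le_mul_of_nonneg_left hv h1l2]
      linarith
    exact mul_le_mul_of_nonneg_right a1 hk
  -- RHS ≥ s m [(1-C) lam² A² - lam lamp d A]
  have s2 : s * m * ((1 - C) * lam ^ 2 * A ^ 2) - A * (lam * lamp * s * m * d)
      ≤ A * ((1 - C) * lam ^ 2 * A * q - lam * lamp * s * m * d) := by
    have : 0 ≤ (1 - C) * lam ^ 2 * A ^ 2 := by positivity
    nlinarith [mul_le_mul_of_nonneg_left hq this]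
  -- LEMMA F times s m
  have s3 : s * m * (lamp * d * (lam * A + (1 - lam ^ 2) * (1 - A))) ≤ s * m * ((1 - C) * lam ^ 2 * A ^ 2) :=
    mul_le_mul_of_nonneg_left hF (by positivity)
  have e3 : s * m * (lamp * d * (lam * A + (1 - lam ^ 2) * (1 - A)))
      = (1 - lam ^ 2) * (1 - A) * (lamp * m) * s * d + A * (lam * lamp * s * m * d) := by ring
  linarith [s1, s2, s3, e3]

/-- **Per-depth flat `(1−A₁)`-budget** (depth `l ≥ 2`, regime `v ≤ λ′m`).  In units of `(1−A)κ_lw_lv_{l+1}`: the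
`(1−A)`-budget is `¾/(Aa_lp_l) + (1−C)/p_l` (RA_l's `¾`-part and the unused K-type kill); the charges are the exact
INEQ-A piece `(1+λ)wṽΘ_l ≤ λw` (THEOREM G-A), the N4 A-part `νA(1−C)ρ` (`ν = (1−λ²)(1+λ)`, `Aρ ≤ 1`) and the new flat need
`¾c`.  They fit whenever `¾c ≤ ¾ − λ(1−λ) − (1−C)(ν−1)` (`hc1`; for `ν ≤ 1` this is weaker than needed).
[cite: KozmaNitzan2024, Question 8 (§5.5 p. 36)] -/
theorem kFl_depth_budget (lam w vt Θ ν A C ρ c Aal pl : ℝ) (hl0 : 0 ≤ lam) (hw0 : 0 ≤ w) (hw : w ≤ 1 - lam)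
    (hGA : (1 + lam) * vt * Θ ≤ lam) (hν : 0 ≤ ν) (hAρ : A * ρ ≤ 1) (hC1 : C ≤ 1)
    (hAal0 : 0 < Aal) (hAal : Aal ≤ 1) (hpl0 : 0 < pl) (hpl : pl ≤ 1)
    (hc1 : 3 / 4 * c ≤ 3 / 4 - lam * (1 - lam) - (1 - C) * (ν - 1)) :
    (1 + lam) * w * vt * Θ + ν * A * (1 - C) * ρ + 3 / 4 * c ≤ 3 / 4 / (Aal * pl) + (1 - C) / pl := by
  have h1C : 0 ≤ 1 - C := by linarith
  -- charges
  have ch1 : (1 + lam) * w * vt * Θ ≤ lam * (1 - lam) := by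
    have : (1 + lam) * w * vt * Θ = w * ((1 + lam) * vt * Θ) := by ring
    rw [this]
    calc w * ((1 + lam) * vt * Θ) ≤ w * lam := mul_le_mul_of_nonneg_left hGA hw0
      _ ≤ (1 - lam) * lam := mul_le_mul_of_nonneg_right hw hl0
      _ = lam * (1 - lam) := by ring
  have ch2 : ν * A * (1 - C) * ρ ≤ (1 - C) * ν := by
    have : ν * A * (1 - C) * ρ = (1 - C) * ν * (A * ρ) := by ring
    rw [this]
    have h0 : 0 ≤ (1 - C) * ν := by positivity
    nlinarith
  -- budgets
  have b1 : 3 / 4 ≤ 3 / 4 / (Aal * pl) := by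
    rw [le_div_iff₀ (by positivity)]
    have : Aal * pl ≤ 1 := by nlinarith
    nlinarith
  have b2 : (1 - C) ≤ (1 - C) / pl := by
    rw [le_div_iff₀ hpl0]
    nlinarith
  -- two cases on ν ≤ 1
  rcases le_or_gt ν 1 with hν1 | hν1
  · have : (1 - C) * ν ≤ 1 - C := by nlinarith
    linarith
  · have : (1 - C) * ν = (1 - C) + (1 - C) * (ν - 1) := by ring
    linarith

/-- **The explicit allowance `c_deep(λ)`** satisfies the hypothesis `hc1` of `kFl_depth_budget`: for
`c = 1 − (4/3)λ(1−λ) − (4/3)λ²M/(1+λ)` with `M ≥ max(1−λ−λ², 0)`, `ν = (1−λ²)(1+λ)` and `(1−C)(1+λ) ≤ λ` (vertex 1 not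
crossed), `C ≤ 1`:  `¾c ≤ ¾ − λ(1−λ) − (1−C)(ν−1)`.
[cite: KozmaNitzan2024, Question 8 (§5.5 p. 36)] -/
theorem kFl_cdeep_ok (lam C M ν c : ℝ) (hl0 : 0 ≤ lam) (hC : (1 - C) * (1 + lam) ≤ lam) (hC1 : C ≤ 1)
    (_hM0 : 0 ≤ M) (hM : 1 - lam - lam ^ 2 ≤ M) (hν : ν = (1 - lam ^ 2) * (1 + lam))
    (hc : c = 1 - 4 / 3 * lam * (1 - lam) - 4 / 3 * lam ^ 2 * M / (1 + lam)) :
    3 / 4 * c ≤ 3 / 4 - lam * (1 - lam) - (1 - C) * (ν - 1) := by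
  have h1l : (0:ℝ) < 1 + lam := by linarith
  have hq : 0 ≤ lam ^ 2 * M / (1 + lam) := by positivity
  have hν1 : ν - 1 = lam * (1 - lam - lam ^ 2) := by rw [hν]; ring
  have e : 3 / 4 * c = 3 / 4 - lam * (1 - lam) - lam ^ 2 * M / (1 + lam) := by rw [hc]; ring
  rw [hν1, e]
  have h1C : 0 ≤ 1 - C := by linarith
  rcases le_or_gt 0 (1 - lam - lam ^ 2) with hs | hs
  · -- (1-C)·lam·(1-lam-lam²) ≤ lam²(1-lam-lam²)/(1+lam) ≤ lam² M/(1+lam), using (1-C)(1+lam) ≤ lam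
    have a1 : (1 - C) * (lam * (1 - lam - lam ^ 2)) ≤ lam ^ 2 * M / (1 + lam) := by
      rw [le_div_iff₀ h1l]
      have b1 : (1 - C) * (lam * (1 - lam - lam ^ 2)) * (1 + lam) = ((1 - C) * (1 + lam)) * (lam * (1 - lam - lam ^ 2)) := by
        ring
      have b2 : ((1 - C) * (1 + lam)) * (lam * (1 - lam - lam ^ 2)) ≤ lam * (lam * (1 - lam - lam ^ 2)) :=
        mul_le_mul_of_nonneg_right hC (by positivity)
      have b3 : lam * (lam * (1 - lam - lam ^ 2)) ≤ lam ^ 2 * M := by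
        nlinarith [mul_le_mul_of_nonneg_left hM (sq_nonneg lam)]
      linarith [b1, b2, b3]
    linarith [a1]
  · have a2 : (1 - C) * (lam * (1 - lam - lam ^ 2)) ≤ 0 := by
      have : lam * (1 - lam - lam ^ 2) ≤ 0 := by nlinarith
      nlinarith
    linarith [a2, hq]

/-- **Flat THEOREM RED, assembly.**  `Σ_{l<K} t_l = DEF − ΣSL + κ₁·G(B̃₁)` (exact re-rooting), the flat uniform form of the
re-rooted block `G(B̃₁) + c·R♭♭(B̃₁) ≤ 0`, LEMMA B in the form `c·BUD ≤ κ₁·c·R♭♭(B̃₁)` and the prefix lemma `DEF ≤ c·BUD`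
give `Σ_{l<K} t_l ≤ 0`, i.e. `UNIF-G′(1)`.
[cite: KozmaNitzan2024, Question 8 (§5.5 p. 36)] -/
theorem kFl_red_flat (total DEF SL κ₁ G c Rbb BUD : ℝ) (htot : total = DEF - SL + κ₁ * G) (hSL : 0 ≤ SL)
    (hκ : 0 ≤ κ₁) (hflat : G + c * Rbb ≤ 0) (hB : c * BUD ≤ κ₁ * (c * Rbb)) (hDEF : DEF ≤ c * BUD) :
    total ≤ 0 := by
  have : κ₁ * G ≤ -(κ₁ * (c * Rbb)) := by nlinarith [mul_le_mul_of_nonneg_left hflat hκ]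
  linarith

/-! ### Termwise majorants of the prefix pieces (PROOF-RCOS1-G34 §5 STEP 5) in the variables `(λ, λ₁, z, t)`
`z = s·y`, `t = s·x`, `λ₁ = λA s`; all denominators positive. -/

/-- **T5**: `r₅ = (4/3)(1−λ)(1+λ₁)·(cλ′)·M/(λC)` with `M = m̃/p₀ ≤ 1` (only `M ≤ 1` is used), `cλ′ ≤ λ²/(4(1+λ))` (gen 34 `kOS_c_lamp`) and
`1/C ≤ 1+λ`:  `r₅ ≤ (1−λ)λ(1+λ₁)/3`.
[cite: KozmaNitzan2024, Question 8 (§5.5 p. 36)] -/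
theorem kFl_T5 (lam lam1 P M C : ℝ) (hl0 : 0 < lam) (hl1 : lam ≤ 1) (hl1a : 0 ≤ 1 + lam1) (hC0 : 0 < C)
    (hC : 1 ≤ (1 + lam) * C) (hM : M ≤ 1) (hP0 : 0 ≤ P) (hP : P * (4 * (1 + lam)) ≤ lam ^ 2) :
    4 / 3 * (1 - lam) * (1 + lam1) * P * M / (lam * C) ≤ (1 - lam) * lam * (1 + lam1) / 3 := by
  rw [div_le_iff₀ (by positivity)]
  -- need 4(1-lam)(1+lam1) P M ≤ (1-lam) lam² (1+lam1) C ... i.e. 4 P M ≤ lam² C: from P ≤ lam²/(4(1+lam)) and 1 ≤ (1+lam)C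
  have h1 : 4 * P * M ≤ lam ^ 2 * C := by
    have a1 : 4 * P * M ≤ 4 * P := by nlinarith
    have a2 : 4 * P ≤ 4 * P * ((1 + lam) * C) := by nlinarith
    have a3 : 4 * P * ((1 + lam) * C) = (P * (4 * (1 + lam))) * C := by ring
    have a4 : (P * (4 * (1 + lam))) * C ≤ lam ^ 2 * C := mul_le_mul_of_nonneg_right hP (le_of_lt hC0)
    linarith
  have hk : 0 ≤ (1 - lam) * (1 + lam1) := by
    have : 0 ≤ 1 - lam := by linarith
    positivity
  nlinarith [mul_le_mul_of_nonneg_left h1 hk]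

/-- **T2, first branch**: `r₂ = (16/9)(1−λ)A²(1+λ₁)Z/(C D₀)` with `A² ≤ 1`, `1/C ≤ 1+λ`, `D₀ ≥ C(1−z) > 0`:
`r₂ ≤ (16/9)(1−λ)(1+λ)²(1+λ₁)·Z/(1−z)`.
[cite: KozmaNitzan2024, Question 8 (§5.5 p. 36)] -/
theorem kFl_T2a (lam lam1 A C Z D₀ z : ℝ) (hl1 : lam ≤ 1) (hl1a : 0 ≤ 1 + lam1) (hA0 : 0 ≤ A) (hA : A ≤ 1)
    (hC0 : 0 < C) (hC : 1 ≤ (1 + lam) * C) (hZ : 0 ≤ Z) (hz : z < 1) (hD0 : 0 < D₀) (hD : C * (1 - z) ≤ D₀) :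
    16 / 9 * (1 - lam) * A ^ 2 * (1 + lam1) * Z / (C * D₀)
      ≤ 16 / 9 * (1 - lam) * (1 + lam) ^ 2 * (1 + lam1) * Z / (1 - z) := by
  have h1z : 0 < 1 - z := by linarith
  rw [div_le_div_iff₀ (by positivity) h1z]
  -- A²(1-z) ≤ (1+lam)² C D₀
  have h1 : A ^ 2 * (1 - z) ≤ (1 + lam) ^ 2 * (C * D₀) := by
    have a1 : A ^ 2 ≤ 1 := by nlinarith
    have a2 : A ^ 2 * (1 - z) ≤ 1 * (1 - z) := by nlinarith
    have a3 : (1:ℝ) * (1 - z) ≤ ((1 + lam) * C) * ((1 + lam) * C) * (1 - z) := by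
      have : (1:ℝ) ≤ ((1 + lam) * C) * ((1 + lam) * C) := by nlinarith
      nlinarith
    have a4 : ((1 + lam) * C) * ((1 + lam) * C) * (1 - z) = (1 + lam) ^ 2 * C * (C * (1 - z)) := by ring
    have a5 : (1 + lam) ^ 2 * C * (C * (1 - z)) ≤ (1 + lam) ^ 2 * C * D₀ := by
      have : 0 ≤ (1 + lam) ^ 2 * C := by positivity
      nlinarith
    nlinarith
  have hk : 0 ≤ 16 / 9 * (1 - lam) * (1 + lam1) * Z := by
    have : 0 ≤ 1 - lam := by linarith
    positivity
  nlinarith [mul_le_mul_of_nonneg_left h1 hk]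

/-- **T2, second branch**: with the Chebyshev refinement `D₀ ≥ D₂ := 1−λ₁+(1+λ₁)z > 0`:
`r₂ ≤ (16/9)(1−λ)(1+λ)(1+λ₁)·Z/D₂`.
[cite: KozmaNitzan2024, Question 8 (§5.5 p. 36)] -/
theorem kFl_T2b (lam lam1 A C Z D₀ D₂ : ℝ) (hl1 : lam ≤ 1) (hl1a : 0 ≤ 1 + lam1) (hA0 : 0 ≤ A) (hA : A ≤ 1)
    (hC0 : 0 < C) (hC : 1 ≤ (1 + lam) * C) (hZ : 0 ≤ Z) (hD0 : 0 < D₀) (hD2 : 0 < D₂) (hD : D₂ ≤ D₀) :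
    16 / 9 * (1 - lam) * A ^ 2 * (1 + lam1) * Z / (C * D₀)
      ≤ 16 / 9 * (1 - lam) * (1 + lam) * (1 + lam1) * Z / D₂ := by
  rw [div_le_div_iff₀ (by positivity) hD2]
  have h1 : A ^ 2 * D₂ ≤ (1 + lam) * (C * D₀) := by
    have a1 : A ^ 2 * D₂ ≤ 1 * D₂ := by
      have : A ^ 2 ≤ 1 := by nlinarith
      nlinarith
    have a2 : (1:ℝ) * D₂ ≤ ((1 + lam) * C) * D₂ := by nlinarith
    have a3 : ((1 + lam) * C) * D₂ ≤ ((1 + lam) * C) * D₀ := by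
      have : 0 ≤ (1 + lam) * C := by nlinarith
      nlinarith
    nlinarith
  have hk : 0 ≤ 16 / 9 * (1 - lam) * (1 + lam1) * Z := by
    have : 0 ≤ 1 - lam := by linarith
    positivity
  nlinarith [mul_le_mul_of_nonneg_left h1 hk]

/-- **T6**: `r₆ = (16/9)(1−λ)λ²A²(1+λ₁)·r(t + r/4)/((1+λ)C D₀)` with `0 ≤ r ≤ 1−t`, `A² ≤ 1`, `1/C ≤ 1+λ` and
`D₀ ≥ D₆ > 0` (`D₆ = max(1−λt, 1−λ₁)`):  `r₆ ≤ (4/9)(1−λ)λ²(1+λ₁)(1−t)(1+3t)/D₆`.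
[cite: KozmaNitzan2024, Question 8 (§5.5 p. 36)] -/
theorem kFl_T6 (lam lam1 A C D₀ D₆ r t : ℝ) (hl0 : 0 ≤ lam) (hl1 : lam ≤ 1) (hl1a : 0 ≤ 1 + lam1) (hA0 : 0 ≤ A)
    (hA : A ≤ 1) (hC0 : 0 < C) (hC : 1 ≤ (1 + lam) * C) (hr0 : 0 ≤ r) (hr : r ≤ 1 - t) (ht0 : 0 ≤ t)
    (hD0 : 0 < D₀) (hD6 : 0 < D₆) (hD : D₆ ≤ D₀) :
    16 / 9 * (1 - lam) * lam ^ 2 * A ^ 2 * (1 + lam1) * (r * (t + r / 4)) / ((1 + lam) * C * D₀)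
      ≤ 4 / 9 * (1 - lam) * lam ^ 2 * (1 + lam1) * ((1 - t) * (1 + 3 * t)) / D₆ := by
  have h1l : (0:ℝ) < 1 + lam := by linarith
  rw [div_le_div_iff₀ (by positivity) hD6]
  -- r(t + r/4) ≤ (1-t)(1+3t)/4
  have g1 : r * (t + r / 4) ≤ (1 - t) * (1 + 3 * t) / 4 := by
    have : r * (t + r / 4) ≤ (1 - t) * (t + (1 - t) / 4) := by nlinarith
    have e : (1 - t) * (t + (1 - t) / 4) = (1 - t) * (1 + 3 * t) / 4 := by ring
    linarith [e]
  have g1' : 0 ≤ r * (t + r / 4) := by positivity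
  -- A² D₆ ≤ (1+lam) C D₀
  have g2 : A ^ 2 * D₆ ≤ (1 + lam) * C * D₀ := by
    have a1 : A ^ 2 * D₆ ≤ 1 * D₆ := by
      have : A ^ 2 ≤ 1 := by nlinarith
      nlinarith
    have a2 : (1:ℝ) * D₆ ≤ ((1 + lam) * C) * D₆ := by nlinarith
    have a3 : ((1 + lam) * C) * D₆ ≤ ((1 + lam) * C) * D₀ := by
      have : 0 ≤ (1 + lam) * C := by nlinarith
      nlinarith
    nlinarith
  have hk : 0 ≤ 16 / 9 * (1 - lam) * lam ^ 2 * (1 + lam1) := by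
    have : 0 ≤ 1 - lam := by linarith
    positivity
  -- combine: LHS·D₆ = K·A²·(r(t+r/4))·D₆ ≤ K·(r(..))·(1+lam)C D₀ ≤ K·((1-t)(1+3t)/4)(1+lam) C D₀
  have s1 : 16 / 9 * (1 - lam) * lam ^ 2 * A ^ 2 * (1 + lam1) * (r * (t + r / 4)) * D₆
      = (16 / 9 * (1 - lam) * lam ^ 2 * (1 + lam1)) * (r * (t + r / 4)) * (A ^ 2 * D₆) := by ring
  have s2 : (16 / 9 * (1 - lam) * lam ^ 2 * (1 + lam1)) * (r * (t + r / 4)) * (A ^ 2 * D₆)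
      ≤ (16 / 9 * (1 - lam) * lam ^ 2 * (1 + lam1)) * (r * (t + r / 4)) * ((1 + lam) * C * D₀) :=
    mul_le_mul_of_nonneg_left g2 (mul_nonneg hk g1')
  have s3 : (16 / 9 * (1 - lam) * lam ^ 2 * (1 + lam1)) * (r * (t + r / 4)) * ((1 + lam) * C * D₀)
      ≤ (16 / 9 * (1 - lam) * lam ^ 2 * (1 + lam1)) * ((1 - t) * (1 + 3 * t) / 4) * ((1 + lam) * C * D₀) := by
    have : 0 ≤ (1 + lam) * C * D₀ := by positivity
    have := mul_le_mul_of_nonneg_left g1 hk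
    nlinarith [mul_le_mul_of_nonneg_right this (by positivity : (0:ℝ) ≤ (1 + lam) * C * D₀)]
  have s4 : (16 / 9 * (1 - lam) * lam ^ 2 * (1 + lam1)) * ((1 - t) * (1 + 3 * t) / 4) * ((1 + lam) * C * D₀)
      = 4 / 9 * (1 - lam) * lam ^ 2 * (1 + lam1) * ((1 - t) * (1 + 3 * t)) * ((1 + lam) * C * D₀) := by ring
  linarith [s1, s2, s3, s4]

/-- **T3a**: `r₃ = (4/3)(1−μ)·[(1+λ₁)sy]·c·(a r + t)/D₀` with the Chebyshev bound `(1+λ₁)sy ≤ λ₁(1−t)`, `c ≤ λ/(1+λ)`,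
`a r + t ≤ t(1 + (4/3)λ(1−t))` (from `a < (4/3)Aμ t`, `r ≤ 1−t`, `Aμ ≤ λ`) and `1−μ ≤ D₀`:
`r₃ ≤ (4/3)(λ/(1+λ))λ₁(1−t)t(1 + (4/3)λ(1−t))`.
[cite: KozmaNitzan2024, Question 8 (§5.5 p. 36)] -/
theorem kFl_T3a (lam lam1 μ Q c E D₀ t : ℝ) (hl0 : 0 ≤ lam) (hlam1 : 0 ≤ lam1) (hμD : 1 - μ ≤ D₀)
    (hD0 : 0 < D₀) (hQ0 : 0 ≤ Q) (hQ : Q ≤ lam1 * (1 - t)) (hc0 : 0 ≤ c) (hc : c * (1 + lam) ≤ lam) (hE0 : 0 ≤ E)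
    (hE : E ≤ t * (1 + 4 / 3 * lam * (1 - t))) (ht1 : t ≤ 1) :
    4 / 3 * (1 - μ) * Q * c * E / D₀ ≤ 4 / 3 * (lam / (1 + lam)) * lam1 * ((1 - t) * t * (1 + 4 / 3 * lam * (1 - t))) := by
  have h1l : (0:ℝ) < 1 + lam := by linarith
  have hc' : c ≤ lam / (1 + lam) := by rw [le_div_iff₀ h1l]; exact hc
  have hlq : 0 ≤ lam / (1 + lam) := by positivity
  -- (1-μ)/D₀ ≤ 1
  have s1 : 4 / 3 * (1 - μ) * Q * c * E / D₀ ≤ 4 / 3 * Q * c * E := by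
    rw [div_le_iff₀ hD0]
    have : 0 ≤ 4 / 3 * Q * c * E := by positivity
    nlinarith
  have s2 : 4 / 3 * Q * c * E ≤ 4 / 3 * (lam1 * (1 - t)) * (lam / (1 + lam)) * (t * (1 + 4 / 3 * lam * (1 - t))) := by
    have a1 : Q * c ≤ (lam1 * (1 - t)) * (lam / (1 + lam)) := mul_le_mul hQ hc' hc0 (by nlinarith)
    have a2 : Q * c * E ≤ (lam1 * (1 - t)) * (lam / (1 + lam)) * (t * (1 + 4 / 3 * lam * (1 - t))) :=
      mul_le_mul a1 hE hE0 (by positivity)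
    nlinarith
  have e : 4 / 3 * (lam1 * (1 - t)) * (lam / (1 + lam)) * (t * (1 + 4 / 3 * lam * (1 - t)))
      = 4 / 3 * (lam / (1 + lam)) * lam1 * ((1 - t) * t * (1 + 4 / 3 * lam * (1 - t))) := by ring
  linarith [s1, s2, e]

end PocketCert

end Summit.CriticalPhenomena.PercolationContinuityZ3.Theorems
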